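import Mathlib
import Summits.KontsevichZagierPeriods.Zeta5Search.LeadingDigitProof
import Summits.KontsevichZagierPeriods.Zeta5Search.GHatClassCongr
import HarnessLib

/-!
# ζ(5) search — the universal first digit of the `W`-row: `W_x = (−p)^{E_x+3}(ĝ_q·ŵ_x + O(p))` (gen-2 g9's U-W)

Cell `pub-zeta5` (HONEST FRAMING: systematic search; no irrationality claim unless certified), P1 prover seat
generation 5.  gen-2 g9 (REPORT-gen2-g9 §1.3b, statement `WDigit` of the staged `G9UniversalDigit.lean`, exact check 29,384
classes): for a residue class `x` with a pole `q`, the class piece `W_x := Σ_{s ∈ x} c_{2,s}` of the ζ(3)-coefficient satisfies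
**`v_p(W_x − (−p)^{E_x+3}·ĝ_q·ŵ_x) ≥ E_x + 4`**, `ŵ_x = Σ_{poles of order ≥ 3} ρ_{s,3}` (`wHat`): the leading digit of the whole
row is the class-constant unit `ĝ` times a universal function of the exponent TYPE of the class.  This is the row system of
the `RecordCellA` proof, for arbitrary classes.  Proof: Theorem B (`leadingDigit_holds`, typer g8) at `σ = 3` for every pole of
order `≥ 3`, `c_{2,s} = 0` at the other class points, `ĝ_s ≡ ĝ_q` (G1, `gHat_classCongr`) and the `p`-integrality of the
`ρ`'s (`padicNorm_classRho_le_one`, from `Gnear_bound`).  Proved with literally gen-2's statement body (`wDigit`); `wHat` is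
defined here with gen-2's body (to be shared with `UniversalDigit.lean` when that statement file is filed).  `p`-adic
valuations of rational numbers; nothing about irrationality.
-/

noncomputable section

open Finset PowerSeries

namespace Summit.KontsevichZagierPeriods.Zeta5Search.CellA

open Summit.KontsevichZagierPeriods.Zeta5Search.DualSeries (InBox)
open Summit.KontsevichZagierPeriods.Zeta5Search.WedgeDictionary (IsPFData pfData)
open Summit.KontsevichZagierPeriods.Zeta5Search.CasoratianValuation (InPolytope)
open Summit.KontsevichZagierPeriods.Zeta5Search.ClusterValuation
open Summit.KontsevichZagierPeriods.Zeta5Search.PadicSeries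
open Literature.NumberTheory.Transcendental.BallRivoal (harm)

variable {p : ℕ} [hp : Fact p.Prime]

/-! ### gen-2 g9's type invariants (bodies verbatim from `G9UniversalDigit.lean` §1) -/

/-- The poles of the class of `x`: class points of negative net exponent. -/
def classPoles (b : ℕ → ℤ) (p x : ℕ) : Finset ℕ := (classSet b p x).filter fun q => netExp b q < 0

/-- `ŵ_x := Σ_{poles q ∈ x of order ≥ 3} ρ_{q,3}`. -/
def wHat (b : ℕ → ℤ) (p x : ℕ) : ℚ :=
  ∑ q ∈ classPoles b p x, if netExp b q ≤ -3 then classRho b p q 3 else 0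

/-! ### The `ρ`'s are `p`-integral -/

/-- **`‖ρ_{q,σ}‖_p ≤ 1`** in the window `b₀ < p²` (the levels are units): from the slope-`1` bound of the near part. -/
theorem padicNorm_classRho_le_one (b : ℕ → ℤ) (h0 : 0 ≤ b 0) {q : ℕ} (hq : q ≤ (b 0).toNat) (hn : (b 0).toNat < p ^ 2)
    (hp2 : p ≠ 2) (σ : ℕ) : padicNorm p (classRho b p q σ) ≤ 1 := by
  have hp0 : p ≠ 0 := hp.out.ne_zero
  have hp' : (-(p : ℚ)) ≠ 0 := neg_ne_zero.2 (Nat.cast_ne_zero.2 hp0)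
  set κ := (-netExp b q).toNat - σ with hκ
  have hres := congrArg (coeff κ) (rescale_Gnear hp0 b h0 hq)
  rw [coeff_rescale, coeff_C_mul] at hres
  -- hres : (-p)^κ * coeff κ Gnear = (-p)^(E - e_q) * coeff κ classCofactor
  have hρ : classRho b p q σ = (-(p : ℚ)) ^ ((κ : ℤ) - (classExp b p q - netExp b q)) * coeff κ (Gnear b p q) := by
    have hE0 : (-(p : ℚ)) ^ (classExp b p q - netExp b q) ≠ 0 := zpow_ne_zero _ hp'
    rw [classRho, ← hκ, ← mul_right_inj' hE0, ← hres, ← mul_assoc, ← zpow_add₀ hp', ← zpow_natCast]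
    congr 2; ring
  rw [hρ, padicNorm.mul]
  have hG := (Gnear_bound b h0 hq hn hp2) κ
  have hpow : padicNorm p ((-(p : ℚ)) ^ ((κ : ℤ) - (classExp b p q - netExp b q))) =
      (p : ℚ) ^ (-((κ : ℤ) - (classExp b p q - netExp b q))) := by
    rw [padicNorm.eq_zpow_of_nonzero (zpow_ne_zero _ hp'), padicValRat.zpow, padicValRat.neg,
      padicValRat.self hp.out.one_lt, mul_one]
  rw [hpow]
  calc (p : ℚ) ^ (-((κ : ℤ) - (classExp b p q - netExp b q))) * padicNorm p (coeff κ (Gnear b p q))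
      ≤ (p : ℚ) ^ (-((κ : ℤ) - (classExp b p q - netExp b q))) * (p : ℚ) ^ (1 * (κ : ℤ) - (classExp b p q - netExp b q)) :=
        mul_le_mul_of_nonneg_left hG (zpow_p_nonneg _)
    _ = 1 := by
        rw [← zpow_add₀ (Nat.cast_ne_zero.2 hp0)]
        have : -((κ : ℤ) - (classExp b p q - netExp b q)) + (1 * (κ : ℤ) - (classExp b p q - netExp b q)) = 0 := by ring
        rw [this, zpow_zero]

/-! ### U-W -/

/-- Coefficients beyond the pole order vanish: `c_{o,s} = 0` for `o ≥ −netExp s`. -/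
theorem pfData_eq_zero_of_order_le (b : ℕ → ℤ) (hb : InPolytope b) {s : ℕ} (hs : s ≤ (b 0).toNat) {o : ℕ} (ho : o < 6)
    (hord : -netExp b s ≤ (o : ℤ)) : pfData b o s = 0 := by
  obtain ⟨hbox, h2, h3⟩ := hb
  have hhalf : ∀ j ∈ range 7, 2 * b (j + 1) ≤ b 0 + 1 := fun j hj => by have := h2 j hj; omega
  obtain ⟨c, hc⟩ := WedgeDictionary.exists_isPFData b hbox (by omega)
  have hid := pf_eq_coeff_Gser b hbox hhalf (WedgeDictionary.isPFData_pfData hc) hs ho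
  have hm := mult_eq_netExp b s
  rw [coeff_X_pow_mul', if_neg (by omega)] at hid
  exact hid

/-- **U-W (gen-2 g9, `WDigit`)**: the first digit of the `W`-row of a class is `ĝ_q·ŵ_x`. -/
theorem wDigit : ∀ (b : ℕ → ℤ) (p x q : ℕ), InPolytope b → p.Prime → 5 ≤ p → (b 0 + 2 : ℤ) < (p : ℤ) ^ 2 → x < p →
    q ∈ classSet b p x → netExp b q < 0 →
      (∑ s ∈ classSet b p x, pfData b 2 s) - (-(p : ℚ)) ^ (classExp b p x + 3) * gHat b p q * wHat b p x ≠ 0 →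
        classExp b p x + 4 ≤
          padicValRat p ((∑ s ∈ classSet b p x, pfData b 2 s) - (-(p : ℚ)) ^ (classExp b p x + 3) * gHat b p q * wHat b p x) := by
  intro b p x q hb hprime hp5 hwin hx hq hqpole hne
  haveI : Fact p.Prime := ⟨hprime⟩
  obtain ⟨hbox, -, -, hn⟩ := thmA_data b hb hwin
  have h0 : 0 ≤ b 0 := hbox.1
  have hp2 : p ≠ 2 := by omega
  have hp' : (-(p : ℚ)) ≠ 0 := neg_ne_zero.2 (Nat.cast_ne_zero.2 hprime.ne_zero)
  set E := classExp b p x with hE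
  -- rewrite ŵ as a sum over the whole class
  have hw : wHat b p x = ∑ s ∈ classSet b p x, (if netExp b s ≤ -3 then classRho b p s 3 else 0) := by
    rw [wHat, classPoles, sum_filter]
    refine sum_congr rfl fun s _ => ?_
    by_cases h3 : netExp b s ≤ -3
    · rw [if_pos (by omega), if_pos h3]
    · rw [if_neg h3]; split_ifs <;> rfl
  have hsplit : (∑ s ∈ classSet b p x, pfData b 2 s) - (-(p : ℚ)) ^ (E + 3) * gHat b p q * wHat b p x =
      ∑ s ∈ classSet b p x, (pfData b 2 s - (-(p : ℚ)) ^ (E + 3) * gHat b p q *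
        (if netExp b s ≤ -3 then classRho b p s 3 else 0)) := by
    rw [hw, mul_sum, ← sum_sub_distrib]
  -- termwise bound `p^{-(E+4)}`
  have hpow : padicNorm p ((-(p : ℚ)) ^ (E + 3)) = (p : ℚ) ^ (-(E + 3)) := by
    rw [padicNorm.eq_zpow_of_nonzero (zpow_ne_zero _ hp'), padicValRat.zpow, padicValRat.neg,
      padicValRat.self hprime.one_lt, mul_one]
  have hgq : padicNorm p (gHat b p q) ≤ 1 := by
    by_cases h0' : gHat b p q = 0
    · rw [h0', padicNorm.zero]; exact zero_le_one
    · have := (gHat_classCongr b p x q q hb hprime hp5 hx hq hq).1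
      rw [padicNorm.eq_zpow_of_nonzero h0', this]; simp
  have hterm : ∀ s ∈ classSet b p x,
      padicNorm p (pfData b 2 s - (-(p : ℚ)) ^ (E + 3) * gHat b p q *
        (if netExp b s ≤ -3 then classRho b p s 3 else 0)) ≤ (p : ℚ) ^ (-(E + 4)) := by
    intro s hs
    have hsn : s ≤ (b 0).toNat := ((mem_classSet_iff b x s).1 hs).1
    by_cases h3 : netExp b s ≤ -3
    · rw [if_pos h3]
      have hEs : classExp b p s = E := classExp_eq_of_mem hs
      -- Theorem B at σ = 3
      have hB : padicNorm p (pfData b 2 s - (-(p : ℚ)) ^ (E + 3) * gHat b p s * classRho b p s 3) ≤ (p : ℚ) ^ (-(E + 4)) := by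
        refine padicNorm_le_of_val fun hne' => ?_
        have := leadingDigit_holds b p s 3 hb hprime hp5 hwin hsn (by norm_num) (by omega)
          (by rw [hEs, show ((3 : ℕ) : ℤ) + E = E + 3 by ring]; exact hne')
        rw [hEs, show ((3 : ℕ) : ℤ) + E = E + 3 by ring] at this
        push_cast at this ⊢; linarith
      -- the unit moved from `s` to `q`
      have hgg : padicNorm p (gHat b p s - gHat b p q) ≤ (p : ℚ) ^ (-(1 : ℤ)) := by
        refine padicNorm_le_of_val fun hne' => ?_
        exact (gHat_classCongr b p x s q hb hprime hp5 hx hs hq).2 (sub_ne_zero.1 hne')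
      have hρ := padicNorm_classRho_le_one b h0 hsn hn hp2 3
      have e : pfData b 2 s - (-(p : ℚ)) ^ (E + 3) * gHat b p q * classRho b p s 3 =
          (pfData b 2 s - (-(p : ℚ)) ^ (E + 3) * gHat b p s * classRho b p s 3) +
            (-(p : ℚ)) ^ (E + 3) * (gHat b p s - gHat b p q) * classRho b p s 3 := by ring
      rw [e]
      refine (padicNorm.nonarchimedean (p := p)).trans (max_le hB ?_)
      rw [padicNorm.mul, padicNorm.mul, hpow]
      calc (p : ℚ) ^ (-(E + 3)) * padicNorm p (gHat b p s - gHat b p q) * padicNorm p (classRho b p s 3)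
          ≤ (p : ℚ) ^ (-(E + 3)) * (p : ℚ) ^ (-(1 : ℤ)) * 1 :=
            mul_le_mul (mul_le_mul_of_nonneg_left hgg (zpow_p_nonneg _)) hρ (padicNorm.nonneg _)
              (mul_nonneg (zpow_p_nonneg _) (zpow_p_nonneg _))
        _ = (p : ℚ) ^ (-(E + 4)) := by rw [mul_one, ← zpow_add₀ (Nat.cast_ne_zero.2 hprime.ne_zero)]; ring_nf
    · rw [if_neg h3, mul_zero, sub_zero, pfData_eq_zero_of_order_le b hb hsn (by norm_num) (by push_cast; omega),
        padicNorm.zero]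
      exact zpow_p_nonneg _
  apply val_ge_of_padicNorm_le hne
  rw [hsplit]
  exact padicNorm.sum_le' hterm (zpow_p_nonneg _)

end Summit.KontsevichZagierPeriods.Zeta5Search.CellA

end
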